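import Summits.Ventures.CertifiedQuantumChemistry.Rows.SOSDualReplay
import Summits.Ventures.CertifiedQuantumChemistry.Rows.SOSDualSlices
import Summits.Ventures.CertifiedQuantumChemistry.Rows.MaximalSpinProjectionRows
import Summits.Ventures.CertifiedQuantumChemistry.Rows.SingletRows
import Literature.MathematicalPhysics.QuantumLattice.SectorEigenvalueContinuation
import HarnessLib

/-!
# Ventures/CertifiedQuantumChemistry — Rows/SOSDualSinglet.lean: KERNEL REPLAY of SDP dual certificates WITH THE SPIN ROWS
# (`⟨Ŝ₋Ŝ₊⟩ = 0` and the `Ŝ₊`-vector rows) — the SINGLET-RESTRICTED lower rows (`SingletLowerRow`, `Statement.lean`)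

HONEST FRAMING (verbatim): certified bounds for a stated model Hamiltonian in a stated basis; not a claim about
the real molecule beyond that model.

var-2 (gen 21), zero compute; computable definitions + soundness theorems (no claim node, no model instance, NO BOUND
ASSERTED; instances live in `Certificates/`). Extends the sector replay `Rows/SOSDualCert.lean` / `SOSDualSemantics` /
`SOSDualReplay` / `SOSDualMerge` to the `s2v_0` instances of FORMAT-qcl1 layout `qcl1/0.2.0` (rdm-A `gen_a.py` 0.3.0,
problem meta `s2_row = 0`, `s2_vector_rows = true`): besides the trace and contraction rows (`N̂_τ − n` ideal, `Mult`)
such an instance carries, in the balanced sector `N_α = N_β = n`,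
* ONE row of kind `S2`: `⟨Ŝ₋Ŝ₊⟩ = S(S+1) − M(M+1) = 0`, and
* `2k²` rows of kind `S+vec`: `⟨a†_{pβ} a_{qα} Ŝ₊⟩ = 0` (side `XS+`) and `⟨Ŝ₊ a†_{pβ} a_{qα}⟩ = 0` (side `S+X`),
each with a rational dual multiplier `λ_r` entering the SOS identity as `−(λ_r/2)(J_r + J_r†)` (`J_r` the row's operator).
Since `Ŝ₋Ŝ₊ = Σ_q (a†_{qβ} a_{qα}) Ŝ₊`, ONE datum suffices: a SPIN MULTIPLIER `SpinMult = (num, den, word X, side)` (stored by the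
data files as the plain tuple `SpinMultData`, read by `SpinMult.ofData`) denoting
`q · (J + J†)` with `J = X·Ŝ₊` (side `0`) or `J = Ŝ₊·X` (otherwise), `Ŝ₊ = Σ_r a†_{r↑} a_{r↓}` (`spinPlus`); the `S2` row
becomes `k` spin multipliers `X = a†_{qβ} a_{qα}`, `q = λ/2`, side `0`.

SOUNDNESS (this file): for `ψ` in the sector `(n, n)` with `Ŝ₊ψ = 0` one has `Ŝ₋ψ = 0` as well
(`spinMinus_mulVec_eq_zero_of_balanced`, rdm-A `Rows/MaximalSpinProjectionRows.lean`), hence `⟨ψ, X Ŝ₊ ψ⟩ = ⟨ψ, Ŝ₋ X† ψ⟩ =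
⟨ψ, Ŝ₊ X ψ⟩ = ⟨ψ, X† Ŝ₋ ψ⟩ = 0`: the spin-multiplier part VANISHES on the singlet subspace `singletSector k n` exactly as
the `N̂_τ − n` part vanishes on the sector; the Gram part is nonnegative on every vector; so a polynomial `P` denoting
`H_F − E_core − Gram − Mult − SpinMult` with `lo ≤ E_core + const(P) − ℓ¹(P)` proves `lo ≤ E₀(H_F; N = 2n, S = 0)` =
`SingletLowerRow F n lo` (`singletLowerRow_of_evalPoly_eq`; the `sInf` over unit vectors of the singlet subspace is bounded
from below vector by vector — `singletLowerRow_of_forall`, no eigenvector is needed). The block-wise / sliced / encoded-merge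
chain machinery of the sector replay applies unchanged (it is about `Terms k`); `termOp_negTerms_spinMultTermsL_slices` cuts
the spin-multiplier step into slices like `SOSDual.termOp_negTerms_multTerms_slices`.

Reader evidence (Python, exact rationals, `pub-qchem-var2` reader-C + the two row kinds): the bound recomputed with these
semantics EQUALS `claimed.lower_bound` of `TVH_L4_N4_U300_na2_nb2_DQG_s2v_0_ring` (CERTIFIED row #167) and of
`TVH_L6_N6_U30_na3_nb3_DQG_s2v_0_ring` (row #169). References: FORMAT-qcl1 v0.3.0 §2–§7 (HOME `pub-qchem-rdm/FORMAT-qcl1.md`);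
D. A. Mazziotti, Phys. Rev. A 72 (2005) 032510 (spin- and symmetry-adapted 2-RDM conditions).
-/

namespace Summit.Ventures.CertifiedQuantumChemistry

open Matrix
open Literature.MathematicalPhysics.QuantumLattice Literature.MathematicalPhysics.QuantumChemistry
open CARPoly
open scoped ComplexOrder

namespace SOSDual

/-! ## Spin-multiplier data and term lists (computable) -/

section Computable

variable {k : ℕ}

/-- One SPIN multiplier: coefficient `(−1)^num ⌊num/2⌋ / den`, word `X` (letter codes as in `Mult`), side of `Ŝ₊`
(`0`: `J = X·Ŝ₊`; otherwise `J = Ŝ₊·X`). Denotes `q · (J + J†)`. -/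
structure SpinMult where
  /-- sign-encoded numerator -/
  num : ℕ
  /-- denominator -/
  den : ℕ
  /-- the word `X` (letter codes) -/
  word : List ℕ
  /-- side of `Ŝ₊`: `0` = right (`X·Ŝ₊`), otherwise left (`Ŝ₊·X`) -/
  side : ℕ

/-- The rational coefficient of a spin multiplier. -/
def SpinMult.coeff (M : SpinMult) : ℚ := (zdec M.num : ℚ) / M.den

/-- Spin-multiplier data as a plain tuple `(num, den, word, side)` — the shape in which DATA files (which import only
`Rows/SOSDualCert.lean`) store it. -/
abbrev SpinMultData := ℕ × ℕ × List ℕ × ℕ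

/-- Read a spin multiplier from its tuple. -/
def SpinMult.ofData (t : SpinMultData) : SpinMult := ⟨t.1, t.2.1, t.2.2.1, t.2.2.2⟩

/-- The `r`-th summand word of `Ŝ₊`: `a†_{r↑} a_{r↓}`. -/
def spWord (r : Fin k) : List (Orb (Fin k) × Bool) := [(orb r 0, true), (orb r 1, false)]

/-- The `r`-th summand word of `J`: `X a†_{r↑} a_{r↓}` (side `0`) or `a†_{r↑} a_{r↓} X`. -/
def spinJWord (X : List (Orb (Fin k) × Bool)) (side : ℕ) (r : Fin k) : List (Orb (Fin k) × Bool) :=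
  if side = 0 then X ++ spWord r else spWord r ++ X

/-- Terms of `q · (J + J†)` for a decoded spin multiplier. -/
def spinMultTermsOf (q : ℚ) (X : List (Orb (Fin k) × Bool)) (side : ℕ) : Terms k :=
  (finList k).flatMap fun r => [(spinJWord X side r, q), (dagger (spinJWord X side r), q)]

/-- Spin-multiplier terms of a LIST of spin multipliers. -/
def spinMultTermsL (k : ℕ) [NeZero k] (ms : List SpinMult) : Terms k :=
  ms.flatMap fun M => spinMultTermsOf M.coeff (decWord k M.word) M.side

/-- ALL terms of a singlet certificate in the balanced sector `(n, n)`: `(H_F − E_core) − Gram − Mult − SpinMult`. -/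
def singletCertTerms [NeZero k] (F : Model k) (n : ℕ) (c : Cert) (ms : List SpinMult) : Terms k :=
  certTerms F n n c ++ negTerms (spinMultTermsL k ms)

/-- **The kernel bound** (monolithic form): `E_core + const − ℓ¹(rest)` of the collected normal form of `singletCertTerms`. -/
def singletSosBound [NeZero k] (F : Model k) (n : ℕ) (c : Cert) (ms : List SpinMult) : ℚ :=
  F.ecore + lowerConst (normalize encL (2 * k + 2) (singletCertTerms F n c ms))

end Computable

/-! ## Semantics of the spin-multiplier terms -/

section Semantics

variable {k : ℕ}

/-- The operator `J` of a spin multiplier with word operator `X`. -/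
noncomputable def spinJ (X : Op k) (side : ℕ) : Op k := if side = 0 then X * spinPlus else spinPlus * X

/-- The `Ŝ₊` summand word denotes `a†_{r↑} a_{r↓}`. -/
theorem ladderWord_spWord (r : Fin k) : ladderWord (spWord r) = creation (orb r 0) * annihilation (orb r 1) := by
  simp [spWord, ladderWord_cons, ladderLetter]

/-- `Σ_r a†_{r↑} a_{r↓} = Ŝ₊`. -/
theorem sum_ladderWord_spWord : ∑ r : Fin k, ladderWord (spWord r) = (spinPlus : Op k) := by
  simp only [ladderWord_spWord, spinPlus]

/-- The `J`-summand word denotes the `r`-th summand of `J`. -/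
theorem ladderWord_spinJWord (X : List (Orb (Fin k) × Bool)) (side : ℕ) (r : Fin k) :
    ladderWord (spinJWord X side r) =
      if side = 0 then ladderWord X * ladderWord (spWord r) else ladderWord (spWord r) * ladderWord X := by
  unfold spinJWord
  split_ifs <;> rw [ladderWord_append']

/-- `Σ_r` of the `J`-summands is `J`. -/
theorem sum_ladderWord_spinJWord (X : List (Orb (Fin k) × Bool)) (side : ℕ) :
    ∑ r : Fin k, ladderWord (spinJWord X side r) = spinJ (ladderWord X) side := by
  simp only [ladderWord_spinJWord, spinJ]
  split_ifs
  · rw [← Finset.mul_sum, sum_ladderWord_spWord]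
  · rw [← Finset.sum_mul, sum_ladderWord_spWord]

/-- The spin-multiplier term list denotes `q · (J + J†)`. -/
theorem termOp_spinMultTermsOf (q : ℚ) (X : List (Orb (Fin k) × Bool)) (side : ℕ) :
    termOp (spinMultTermsOf q X side) = ((q : ℚ) : ℂ) • (spinJ (ladderWord X) side + (spinJ (ladderWord X) side)ᴴ) := by
  unfold spinMultTermsOf
  rw [termOp_flatMap]
  have h : (List.map (fun r : Fin k => termOp [(spinJWord X side r, q), (dagger (spinJWord X side r), q)]) (finList k)).sum =
      ∑ r : Fin k, ((q : ℚ) : ℂ) • (ladderWord (spinJWord X side r) + (ladderWord (spinJWord X side r))ᴴ) := by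
    rw [← sum_map_finList]
    congr 1
    refine List.map_congr_left fun r _ => ?_
    rw [termOp_cons, termOp_cons, termOp_nil, add_zero, ladderWord_dagger, smul_add]
  rw [h, ← Finset.smul_sum, Finset.sum_add_distrib, ← Matrix.conjTranspose_sum, sum_ladderWord_spinJWord]

/-- `⟨ψ, Ŝ₋ X ψ⟩ = ⟨Ŝ₊ψ, Xψ⟩ = 0` for a vector annihilated by `Ŝ₊`. -/
theorem expect_spinMinus_mul_eq_zero {ψ : Fock (Orb (Fin k))} (hP : spinPlus *ᵥ ψ = 0) (X : Op k) :
    star ψ ⬝ᵥ (spinMinus * X) *ᵥ ψ = 0 := by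
  have h : star ψ ᵥ* (spinMinus : Op k) = star (spinPlus *ᵥ ψ) := by
    rw [star_mulVec, spinMinus]
  rw [← mulVec_mulVec, dotProduct_mulVec, h, hP, star_zero, zero_dotProduct]

/-- `⟨ψ, X Ŝ₋ ψ⟩ = 0` for a vector annihilated by `Ŝ₋`. -/
theorem expect_mul_spinMinus_eq_zero {ψ : Fock (Orb (Fin k))} (hM : spinMinus *ᵥ ψ = 0) (X : Op k) :
    star ψ ⬝ᵥ (X * spinMinus) *ᵥ ψ = 0 := by
  rw [← mulVec_mulVec, hM, mulVec_zero, dotProduct_zero]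

/-- `Ŝ₊ᴴ = Ŝ₋` (the tree's definition of `spinMinus`, as a rewrite rule). -/
theorem conjTranspose_spinPlus : (spinPlus : Op k)ᴴ = spinMinus := rfl

/-- **`J + J†` has zero expectation in every vector killed by `Ŝ₊` and `Ŝ₋`.** -/
theorem dotProduct_spinJ_add_eq_zero (X : Op k) (side : ℕ) {ψ : Fock (Orb (Fin k))} (hP : spinPlus *ᵥ ψ = 0)
    (hM : spinMinus *ᵥ ψ = 0) : star ψ ⬝ᵥ ((spinJ X side + (spinJ X side)ᴴ) *ᵥ ψ) = 0 := by
  unfold spinJ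
  split_ifs
  · rw [Matrix.add_mulVec, dotProduct_add, conjTranspose_mul, conjTranspose_spinPlus, expect_mul_spinPlus_eq_zero hP,
      expect_spinMinus_mul_eq_zero hP, add_zero]
  · rw [Matrix.add_mulVec, dotProduct_add, conjTranspose_mul, conjTranspose_spinPlus, expect_spinPlus_mul_eq_zero hM,
      expect_mul_spinMinus_eq_zero hM, add_zero]

/-- **The spin-multiplier part vanishes on every singlet of the balanced sector.** -/
theorem dotProduct_spinMultTerms_eq_zero [NeZero k] {n : ℕ} (ms : List SpinMult) {ψ : Fock (Orb (Fin k))}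
    (hψ : IsInSector n n ψ) (hP : spinPlus *ᵥ ψ = 0) : star ψ ⬝ᵥ (termOp (spinMultTermsL k ms) *ᵥ ψ) = 0 := by
  have hM : spinMinus *ᵥ ψ = 0 := spinMinus_mulVec_eq_zero_of_balanced hψ hP
  unfold spinMultTermsL
  rw [termOp_flatMap, listSum_mulVec, dotProduct_listSum]
  refine List.sum_eq_zero fun x hx => ?_
  obtain ⟨M, -, rfl⟩ := List.mem_map.1 hx
  rw [termOp_spinMultTermsOf, Matrix.smul_mulVec, dotProduct_smul, dotProduct_spinJ_add_eq_zero _ _ hP hM, smul_zero]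

/-- The singlet term list denotes `(H_F − E_core) − Gram − Mult − SpinMult`. -/
theorem termOp_singletCertTerms [NeZero k] (F : Model k) (n : ℕ) (c : Cert) (ms : List SpinMult) :
    termOp (singletCertTerms F n c ms) = termOp (hamTerms F) + termOp (negTerms (gramTerms k c)) +
      termOp (negTerms (multTerms k n n c)) + termOp (negTerms (spinMultTermsL k ms)) := by
  rw [singletCertTerms, certTerms, termOp_append, termOp_append, termOp_append]

end Semantics

/-! ## The singlet replay theorem -/

section Main

variable {k : ℕ}

/-- **Lower bounds transfer to the singlet energy, vector by vector**: if `lo·‖ψ‖² ≤ Re ⟨ψ, H_F ψ⟩` for every `ψ` of the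
sector `(n, n)` with `Ŝ₊ψ = 0`, and `n ≤ k`, then `SingletLowerRow F n lo` (the singlet subspace is nonzero: a closed-shell
determinant; `Model.singletEnergy` is an infimum over its unit vectors). -/
theorem singletLowerRow_of_forall {F : Model k} {n : ℕ} (hn : n ≤ k) {lo : ℚ}
    (h : ∀ ψ : Fock (Orb (Fin k)), IsInSector n n ψ → spinPlus *ᵥ ψ = 0 →
      (lo : ℝ) * (star ψ ⬝ᵥ ψ).re ≤ (star ψ ⬝ᵥ (F.hamiltonian *ᵥ ψ)).re) :
    SingletLowerRow F n lo := by
  refine ⟨hn, ?_⟩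
  have hK : singletSector k n ≠ ⊥ := by
    unfold singletSector
    exact szSector_inf_ker_spinPlus_ne_bot (by simpa using hn)
  have hmem : ∀ ψ ∈ singletSector k n, IsInSector n n ψ ∧ spinPlus *ᵥ ψ = 0 := fun ψ hψ => by
    rw [mem_singletSector_iff] at hψ
    exact ⟨(mem_szSector_iff_isInSector n n ψ).1 hψ.1, hψ.2⟩
  obtain ⟨w, hwK, hw0⟩ := Submodule.exists_mem_ne_zero_of_ne_bot hK
  obtain ⟨r, -, -, hr1⟩ := EigenvalueContinuation.exists_normalize hw0
  unfold Model.singletEnergy Matrix.minEnergyOn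
  refine le_csInf ⟨_, _, (singletSector k n).smul_mem _ hwK, hr1, rfl⟩ ?_
  rintro E ⟨ψ, hψK, hψ1, rfl⟩
  have key := h ψ (hmem ψ hψK).1 (hmem ψ hψK).2
  rwa [hψ1, Complex.one_re, mul_one] at key

/-- **KERNEL REPLAY OF A SINGLET SOS / DUAL CERTIFICATE (pieces form).** For a balanced sector `(n, n)` in range and ANY
certificate data `c`, spin multipliers `ms`: if `HT` denotes `H_F − E_core·1`, `P` denotes `HT − Gram − Mult − SpinMult`
and `lo ≤ E_core + constCoeff P − ℓ¹(P)`, then `SingletLowerRow F n lo`. -/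
theorem singletLowerRow_of_pieces [NeZero k] {F : Model k} {n : ℕ} (hn : n ≤ k) (c : Cert) (ms : List SpinMult)
    (P : CARPoly.Poly (Orb (Fin k))) (HT : Terms k) (hHT : termOp HT = F.hamiltonian - (F.ecore : ℂ) • (1 : Op k))
    (hP : evalPoly id P = termOp HT + termOp (negTerms (gramTerms k c)) + termOp (negTerms (multTerms k n n c)) +
      termOp (negTerms (spinMultTermsL k ms)))
    {lo : ℚ} (h : lo ≤ F.ecore + lowerConst P) : SingletLowerRow F n lo := by
  refine singletLowerRow_of_forall hn fun ψ hψ hSψ => ?_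
  have hq := re_quadForm_evalPoly_ge id P ψ
  rw [hP, hHT, termOp_negTerms, termOp_negTerms, termOp_negTerms,
    Matrix.add_mulVec, Matrix.add_mulVec, Matrix.add_mulVec, Matrix.sub_mulVec, Matrix.neg_mulVec, Matrix.neg_mulVec,
    Matrix.neg_mulVec, dotProduct_add, dotProduct_add, dotProduct_add, dotProduct_sub, dotProduct_neg, dotProduct_neg,
    dotProduct_neg, dotProduct_multTerms_eq_zero c hψ, dotProduct_spinMultTerms_eq_zero ms hψ hSψ, Matrix.smul_mulVec,
    Matrix.one_mulVec, dotProduct_smul, smul_eq_mul] at hq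
  have hG := re_gramTerms_nonneg c ψ (k := k)
  have hE : (((F.ecore : ℚ) : ℂ) * (star ψ ⬝ᵥ ψ)).re = ((F.ecore : ℚ) : ℝ) * (star ψ ⬝ᵥ ψ).re := by
    rw [← Complex.ofReal_ratCast, Complex.re_ofReal_mul]
  simp only [Complex.add_re, Complex.sub_re, Complex.neg_re, neg_zero, add_zero, hE] at hq
  have hnn : 0 ≤ (star ψ ⬝ᵥ ψ).re := (Complex.nonneg_iff.1 (dotProduct_star_self_nonneg _)).1
  have hlo : ((lo : ℚ) : ℝ) ≤ ((F.ecore : ℚ) : ℝ) + ((lowerConst P : ℚ) : ℝ) := by exact_mod_cast h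
  nlinarith [mul_nonneg (sub_nonneg.2 hlo) hnn]

/-- **KERNEL REPLAY OF A SINGLET SOS / DUAL CERTIFICATE.** If a polynomial `P` denotes the operator of
`singletCertTerms F n c ms` (e.g. a block-wise pre-collected / encoded-merge accumulated version of it) and
`lo ≤ E_core + constCoeff P − ℓ¹(P)`, then `SingletLowerRow F n lo` (`lo ≤ E₀(H_F; N = 2n, S = 0)`). -/
theorem singletLowerRow_of_evalPoly_eq [NeZero k] {F : Model k} {n : ℕ} (hn : n ≤ k) (c : Cert) (ms : List SpinMult)
    (P : CARPoly.Poly (Orb (Fin k))) (hP : evalPoly id P = termOp (singletCertTerms F n c ms)) {lo : ℚ}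
    (h : lo ≤ F.ecore + lowerConst P) : SingletLowerRow F n lo :=
  singletLowerRow_of_pieces hn c ms P (hamTerms F) (termOp_hamTerms F) (by rw [hP, termOp_singletCertTerms]) h

/-- **Monolithic form**: `lo ≤ singletSosBound F n c ms → SingletLowerRow F n lo` (`decide +kernel` for tiny certificates). -/
theorem singletLowerRow_of_singletSosBound [NeZero k] {F : Model k} {n : ℕ} (hn : n ≤ k) (c : Cert) (ms : List SpinMult)
    {lo : ℚ} (h : lo ≤ singletSosBound F n c ms) : SingletLowerRow F n lo :=
  singletLowerRow_of_evalPoly_eq hn c ms _ (evalPoly_normalize_id _ _ _) h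

end Main

/-! ## Slicing the spin-multiplier part (for chain files) -/

section Slices

variable {k : ℕ} [NeZero k]

/-- `spinMultTermsL` is additive in the multiplier list. -/
theorem spinMultTermsL_append (m₁ m₂ : List SpinMult) :
    spinMultTermsL k (m₁ ++ m₂) = spinMultTermsL k m₁ ++ spinMultTermsL k m₂ := by
  simp [spinMultTermsL, List.flatMap_append]

/-- The (negated) spin-multiplier operator of a flattened family of lists is the sum over the family. -/
theorem termOp_negTerms_spinMultTermsL_flatten : ∀ L : List (List SpinMult),
    termOp (negTerms (spinMultTermsL k L.flatten)) = (L.map fun ms => termOp (negTerms (spinMultTermsL k ms))).sum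
  | [] => by simp [spinMultTermsL]
  | ms :: L => by
    rw [List.flatten_cons, spinMultTermsL_append, negTerms_append, termOp_append, List.map_cons, List.sum_cons,
      termOp_negTerms_spinMultTermsL_flatten L]

/-- **Slicing the spin-multiplier part**: `−SpinMult(ms) = Σ_slices −SpinMult(slice)` over `slicesFrom ms ns`, ANY `ns`. -/
theorem termOp_negTerms_spinMultTermsL_slices (ms : List SpinMult) (ns : List ℕ) :
    termOp (negTerms (spinMultTermsL k ms)) =
      ((slicesFrom ms ns).map fun s => termOp (negTerms (spinMultTermsL k s))).sum := by
  have h := termOp_negTerms_spinMultTermsL_flatten (k := k) (slicesFrom ms ns)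
  rwa [flatten_slicesFrom] at h

end Slices

end SOSDual

end Summit.Ventures.CertifiedQuantumChemistry
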